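import Summits.QuantumFields.YangMills.Theorems.AllWindowsColdBoxBoxHighLineBoxToChartRelative
import Summits.QuantumFields.YangMills.Theorems.AllWindowsColdBoxBoxHighLineSmallFieldInsideFPByName

/-!
# T-S5.13A, relative form, UNCONDITIONAL — the `ε₁ = 1/8` half of ✓`landauRelativeComparisonBulk_of_split` with T-S5.6 discharged by name
# (LINE-19 S5 ⟨stmt-QuantumFields-24004⟩/⟨24335⟩)

Width seat `ym-line-sfw-p2-w2` (g31).  ✓`BoxToChart.boxPlaqCov_sub_chartCov_relative` (p744992) takes `SmallFieldInsideFP` as a hypothesis; with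
✓`smallFieldInsideFP : SmallFieldInsideFP` (w4 g28, over ✓`ghostTaylor` + ✓`actionSandwich`) it becomes unconditional: for `0 < θ`, `θ/2 < κ₃ < ε₁`,
`2θ < ε₁ < 1/2 − 4θ`, `ε₁ < 1/2 − 6θ + 2κ₃` (a point exists iff `θ < 5/64`, ✓`BoxToChart.exists_exponents`),
`∃ K M L β₀, ∀ β ≥ β₀, ∀ bulk T: |β²·boxPlaqCov β H T − β²·(⟨c₀c_T⟩_D − ⟨c₀⟩_D⟨c_T⟩_D)| ≤ (1/8)·((3/4)·boxDirCircSqCov H T)` with the §1 parameter functions.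

Tree only; no definitions.  HONEST LABEL: bookkeeping for the T-S5.13 assembly of the XL stub S5 of a critic-PASSed DRAFT line; the ε₂ half (13E) and the final
assembly are the LEAD's; S5, U5, ⟨24004⟩ ⟨24335⟩ ⟨24336⟩ remain OPEN; no stub is closed by name, no crux, rung or summit is proved; **the Yang–Mills mass gap is
NOT proved by this file.**
-/

set_option autoImplicit false

noncomputable section

open MeasureTheory
open Literature.MathematicalPhysics.QuantumLattice (fundamentalRep)
open Summit.QuantumFields.YangMills.Theorems.WeakCouplingRates (boxCentre boxPlaqCov boxDirCircSqCov)

namespace Summit.QuantumFields.YangMills.Theorems.AllWindowsColdBoxBoxHighLine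

namespace BoxToChart

/-- ★★★ **T-S5.13A in relative form, unconditional** (`h6 := smallFieldInsideFP`). -/
theorem boxPlaqCov_sub_chartCov_relative' {θ κ₃ ε₁ : ℝ} (hθ : 0 < θ)
    (hκl : θ / 2 < κ₃) (hε₁l : κ₃ < ε₁) (hε₁θ : 2 * θ < ε₁) (hε₁u : ε₁ < 1 / 2 - 4 * θ)
    (hε₁u' : ε₁ < 1 / 2 - 6 * θ + 2 * κ₃) :
    ∃ K M L : ℝ, 0 < K ∧ 1 ≤ M ∧ 1 ≤ L ∧ ∃ β₀ : ℝ, 1 ≤ β₀ ∧ ∀ β : ℝ, β₀ ≤ β → ∀ T : ℕ, L ≤ (T : ℝ) → M * (T : ℝ) ≤ (⌈β ^ θ⌉₊ : ℝ) →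
      ∀ (H : ℕ) (s spl r : ℝ), H = ⌈β ^ θ⌉₊ → s = β ^ (κ₃ - 1 / 2) → spl = β ^ (ε₁ - 1 / 2) →
        r = K * H * (1 + Real.log H) ^ 2 * spl + 1 / ((H : ℝ) ^ 4 * (1 + Real.log β) ^ 2) →
      |β ^ 2 * boxPlaqCov (fundamentalRep (Fin 2)) β H T -
          β ^ 2 * ((∫ a in smallField H s, chartPlaqCost H (boxCentre H) 1 2 a * chartPlaqCost H (boxCentre H + Pi.single 0 (T : ℤ)) 1 2 a *
                fpChartWeight β H r a) / (∫ a in smallField H s, fpChartWeight β H r a) -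
            (∫ a in smallField H s, chartPlaqCost H (boxCentre H) 1 2 a * fpChartWeight β H r a) /
                (∫ a in smallField H s, fpChartWeight β H r a) *
              ((∫ a in smallField H s, chartPlaqCost H (boxCentre H + Pi.single 0 (T : ℤ)) 1 2 a * fpChartWeight β H r a) /
                (∫ a in smallField H s, fpChartWeight β H r a)))| ≤
        1 / 8 * (3 / 4 * boxDirCircSqCov H T) :=
  boxPlaqCov_sub_chartCov_relative smallFieldInsideFP hθ hκl hε₁l hε₁θ hε₁u hε₁u'

end BoxToChart

end Summit.QuantumFields.YangMills.Theorems.AllWindowsColdBoxBoxHighLine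

end
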